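/-
Copyright (c) 2026 the pub-hodgecm-mathlib formalisation cell (harness21).  Prover seat hodgecm-mathlib-F0P2-p11 (g0) (L1; KIND 1 of #41, organ K1-a «singular big-cell term», brick
(R1-α′-1b) of the «cells cut» ★ p861869), Track B «K2-LIT» ∕ hLiu418 #184♮, ROAD Φ: THE HAAR MEASURE OF THE CORNER COMPLEMENT `N_χ(𝔸)` IN THE COORDINATES `(y, x) ↦ n₀₀ y · n₀₁ x`
(Fubini for the `N_χ(𝔸)`-period of ★ p861405).  THEOREMS ONLY.
-/
import Summits.HodgeConjecture.HodgeConjecture.Theorems.K2LiuRankOneBigCellUnfold        -- ★ p861365 `exists_semidirect_integral` (+ ★ FILE A retraction, ★ FILE C Haar transport, ★ α2d-2)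
import Summits.HodgeConjecture.HodgeConjecture.Theorems.K2LiuUnipDeltaPlaneCoordinates    -- ★ p861975 `exists_planeCoordinates`
import HarnessLib

/-!
# Crux `HLiu418`, ROAD Φ, KIND 1 organ K1-a, brick (R1-α′-1b): `∫_{N_χ(𝔸)} φ dμZ = c • ∫_{𝔸_{L⁺}} ∫_{𝔸_L} φ(n₀₀ y · n₀₁ x) dμ_L(x) dμ(y)` — the Haar measure of the corner
# complement `Z = N_χ(𝔸) = {u ∈ N_Δ(𝔸) : w₀ u w₀⁻¹ ∈ P_Δ}` in the plane coordinates of ★ p861975, for the `(Z, μZ)` of ★ p861405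

Cell `hodgecm-mathlib`, crux item hLiu418 = `stmt-HodgeConjecture-24832` (helper lane, count-neutral); squad K2 ∕ K2Liu, LEAD F0P6-plan (g14) (BATCH #52 (8): KIND 1 = F0P2-p11);
prover F0P2-p11 (g0).  THEOREMS ONLY (no `def`, no `instance`, no notation, no named-fact hypothesis, no `sorry`).

WHY.  ★ (R1-α)(a) `K2LiuRankOneBigCellCornerFrame.exists_whittakerDelta_rankOne_eq_corner_integral` writes the singular big-cell term of a rank-one coefficient as a corner-line
integral of the `Z`-PERIOD `∫_Z f(w_Δ·z·g) dμZ(z)`, for SOME closed subgroup `Z ≤ N_Δ(𝔸)` with the membership law `u ∈ Z ↔ w₀ u w₀⁻¹ ∈ P_Δ` and SOME Haar measure `μZ` on it.  The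
K1-a road («`X₀₀`-intertwining of the section, then the `X₀₁`-intertwining of the inner section») needs that period as an ITERATED integral over the two coordinates of ★ p861975
`exists_planeCoordinates` (`Z = n₀₀(𝔸_{L⁺}) · n₀₁(𝔸_L)`, commuting, closed one-parameter families).  This file proves it for EVERY such `(Z, μZ)` and EVERY pair of additive Haar
measures `μ` on `𝔸_{L⁺}`, `μ_L` on `𝔸_L`, with ONE constant `c ∈ (0, ∞)` serving Tonelli AND Bochner — the pattern of ★ p861365 §2 `exists_corner_disintegration`
(retraction `z ↦ n₀₀(im (X_z)₀₀)` ⇒ ★ FILE A `exists_homeomorph_isTopSemidirect_of_retraction` ⇒ ★ `exists_semidirect_integral`; the two factors are transported to `𝔸_{L⁺}`,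
`𝔸_L` along the additive-to-multiplicative homeomorphisms `y ↦ n₀₀ y`, `x ↦ n₀₁ x`, ★ FILE C `isHaarMeasure_map_of_homeomorph_add`; the second factor's Haar measure is CHOSEN as
the transport of `μ_L`, so no second constant appears).
HEAD **`exists_cornerComplement_integral`**: `∃ n₀₀ n₀₁ κ c`, the coordinate clauses of ★ p861975 (continuity, additivity, `N_Δ(𝔸)`-membership, frames, rationality, commutation),
`Z`-membership of both families, `c ≠ 0, ∞`, (LIN) `∫⁻ Φ(z) dμZ = c · ∫⁻_y ∫⁻_x Φ(n₀₀ y · n₀₁ x) dμ_L dμ` for measurable `Φ ≥ 0`, (BOCH) for `μZ`-integrable Banach-valued `φ`: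
`y ↦ ∫_x φ(n₀₀ y · n₀₁ x) dμ_L` is `μ`-integrable and `∫ φ(z) dμZ = c • ∫_y ∫_x φ(n₀₀ y · n₀₁ x) dμ_L dμ`.
References: [MoeglinWaldspurger1995] II.1.7; [KudlaRallis1994] §2; [DeitmarEchterhoff2014] §1.5; Bourbaki *Intégration* VII §2 no. 9; [GelbartPiatetskishapiroRallis1987] Part A §1.
HONEST LABEL.  Count-neutral helper; `HC_CM` is proved only modulo the 7 printed citations (2 remaining named inputs: hLiu418 = `stmt-HodgeConjecture-24832`,
h413 = `stmt-HodgeConjecture-24833`) until rung 0 closes.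
-/

set_option autoImplicit false
set_option linter.dupNamespace false -- the mandated namespace repeats `HodgeConjecture.HodgeConjecture`

noncomputable section

open scoped Matrix ENNReal NNReal
open NumberField IsDedekindDomain MeasureTheory MeasureTheory.Measure Filter Set Function Topology
open Literature.NumberTheory.Automorphic Literature.NumberTheory.Automorphic.UnitaryGroup Literature.NumberTheory.GaloisRepresentations
open Literature.NumberTheory.GelbartRogawski1991 Literature.NumberTheory.GelbartRogawski1991.GRConstruction
open Literature.NumberTheory.K2Lit.SiegelDoubled Literature.MeasureTheory.Group
open Literature.NumberTheory.GelbartRogawski1991.AdaptedBlocks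
open UnitaryDualPair
open Summit.HodgeConjecture.HodgeConjecture.Cruxes.HLiu418.K2LiuCoveringWeightSemidirectUnfold (exists_homeomorph_isTopSemidirect_of_retraction)
open Summit.HodgeConjecture.HodgeConjecture.Cruxes.HLiu418.K2LiuUnipDeltaCornerCoordinates
open Summit.HodgeConjecture.HodgeConjecture.Cruxes.HLiu418.K2LiuUnipDeltaPlaneCoordinates (exists_planeCoordinates)
open Summit.HodgeConjecture.HodgeConjecture.Cruxes.HLiu418.K2LiuSiegelUnipotentCharacters (toBlocks₁₂_blk_mul toBlocks₁₂_blk_one toBlocks₁₂_blk_inv continuous_toBlocks₁₂_blk)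
open Summit.HodgeConjecture.HodgeConjecture.Cruxes.HLiu418.K2LiuConstantTermMiddleCellOrbits (stabilizer_reflStd_iff)
open Summit.HodgeConjecture.HodgeConjecture.Cruxes.HLiu418.K2LiuSiegelUnipotentHaarPinned (locallyCompactSpace_unipDelta secondCountableTopology_unipDelta)
open Summit.HodgeConjecture.HodgeConjecture.Cruxes.HLiu418.K2LiuMiddleInnerSectionUnfold (isHaarMeasure_map_of_homeomorph_add)
open Summit.HodgeConjecture.HodgeConjecture.Cruxes.HLiu418.K2LiuRankOneBigCellUnfold (exists_semidirect_integral)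

namespace Summit.HodgeConjecture.HodgeConjecture.Cruxes.HLiu418.K2LiuRankOneCornerComplementFubini

variable (L : Type) [Field L] [NumberField L] [IsCMField L]
variable {N M : ℕ} (e : Fin N × Fin M ≃ Fin 2)
  (dV : Fin N → L) (hdV : ∀ i, IsCMField.complexConj L (dV i) = dV i)
  (dW : Fin M → L) (hdW : ∀ i, IsCMField.complexConj L (dW i) = dW i)

set_option maxHeartbeats 1600000 in -- the corner-complement assembly over the doubled unitary carriers (same size as ★ p861365 §2 ∕ ★ FILE C)
/-- **THE HAAR MEASURE OF `N_χ(𝔸)` IN PLANE COORDINATES.**  For every closed subgroup `Z ≤ N_Δ(𝔸)` with the membership law `u ∈ Z ↔ w₀ u w₀⁻¹ ∈ P_Δ` (`w₀ = ι(1, g₀)`, the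
middle reflection of pattern `![0,1]`), every Haar measure `μZ` on `Z` and additive Haar measures `μ` on `𝔸_{L⁺}`, `μ_L` on `𝔸_L`, there are the plane coordinates `n₀₀, n₀₁` of
★ p861975 (values in `Z`) and ONE `c ∈ (0, ∞)` with (LIN) `∫⁻ Φ(z) dμZ = c · ∫⁻_y ∫⁻_x Φ(n₀₀ y · n₀₁ x) dμ_L dμ` and (BOCH) `∫ φ(z) dμZ = c • ∫_y ∫_x φ(n₀₀ y · n₀₁ x) dμ_L dμ`
for `μZ`-integrable `φ` (with the integrability of the fibre integral). [cite: MoeglinWaldspurger1995, II.1.7] [cite: DeitmarEchterhoff2014, §1.5] [cite: KudlaRallis1994, §2] -/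
theorem exists_cornerComplement_integral (hdV0 : ∀ i, dV i ≠ 0) (hdW0 : ∀ i, dW i ≠ 0)
    {g₀ : UnitaryGroup.rationalPair (Fp L) L (IsCMField.complexConj L) N M (Matrix.diagonal dV) (Matrix.diagonal dW)}
    (hg₀ : ((g₀ : GL (Fin N × Fin M) L) : Matrix (Fin N × Fin M) (Fin N × Fin M) L) = Matrix.diagonal (fun k => 1 - 2 * (![0, 1] : Fin 2 → L) (e k)))
    (Λ : GL (Fin 2) (AdeleRing (𝓞 L) L) →* HA L e dV hdV dW hdW)
    (hΛ : ∀ g : GL (Fin 2) (AdeleRing (𝓞 L) L), blk L e dV hdV dW hdW (Λ g) =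
      cayR (AdeleRing (𝓞 L) L) (Fin 2) * Matrix.fromBlocks (g : Matrix (Fin 2) (Fin 2) (AdeleRing (𝓞 L) L)) 0 0
        (((gramR L e dV hdV dW hdW).map ((algebraMap L (AdeleRing (𝓞 L) L)).comp (algebraMap (Fp L) L)))⁻¹ *
          (((g⁻¹ : GL (Fin 2) (AdeleRing (𝓞 L) L)) : Matrix (Fin 2) (Fin 2) (AdeleRing (𝓞 L) L)).map
            (conjAdele (Fp L) L (IsCMField.complexConj L)))ᵀ *
          (gramR L e dV hdV dW hdW).map ((algebraMap L (AdeleRing (𝓞 L) L)).comp (algebraMap (Fp L) L))) *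
        cayRinv (AdeleRing (𝓞 L) L) (Fin 2))
    [MeasurableSpace (unipDelta L e dV hdV dW hdW)] [BorelSpace (unipDelta L e dV hdV dW hdW)]
    (Z : Subgroup (unipDelta L e dV hdV dW hdW))
    (hZ : ∀ u : unipDelta L e dV hdV dW hdW, u ∈ Z ↔
      IsSiegelDelta L e dV hdV dW hdW (iotaGG L e dV hdV dW hdW (1, UnitaryGroup.rationalPairToAdelic (Fp L) L (IsCMField.complexConj L) N M (Matrix.diagonal dV) (Matrix.diagonal dW) g₀) *
        (u : HA L e dV hdV dW hdW) *
        (iotaGG L e dV hdV dW hdW (1, UnitaryGroup.rationalPairToAdelic (Fp L) L (IsCMField.complexConj L) N M (Matrix.diagonal dV) (Matrix.diagonal dW) g₀))⁻¹))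
    (μZ : Measure Z) [IsHaarMeasure μZ]
    [MeasurableSpace (AdeleRing (𝓞 (Fp L)) (Fp L))] [BorelSpace (AdeleRing (𝓞 (Fp L)) (Fp L))]
    (μ : Measure (AdeleRing (𝓞 (Fp L)) (Fp L))) [μ.IsAddHaarMeasure]
    [MeasurableSpace (AdeleRing (𝓞 L) L)] [BorelSpace (AdeleRing (𝓞 L) L)]
    (μL : Measure (AdeleRing (𝓞 L) L)) [μL.IsAddHaarMeasure] :
    ∃ (n₀₀ : AdeleRing (𝓞 (Fp L)) (Fp L) → HA L e dV hdV dW hdW) (n₀₁ : AdeleRing (𝓞 L) L → HA L e dV hdV dW hdW)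
      (κ : AdeleRing (𝓞 L) L → AdeleRing (𝓞 L) L) (c : ℝ≥0∞),
      Continuous n₀₀ ∧ (∀ s t, n₀₀ (s + t) = n₀₀ s * n₀₀ t) ∧ (∀ y, n₀₀ y ∈ unipDelta L e dV hdV dW hdW) ∧
      (∀ y, (blk L e dV hdV dW hdW (n₀₀ y)).toBlocks₁₂ =
        Matrix.single (0 : Fin 2) (0 : Fin 2) (AdeleRing.baseChange (Fp L) L y * algebraMap L (AdeleRing (𝓞 L) L) (imagUnit L))) ∧
      (∀ y : Fp L, n₀₀ (algebraMap (Fp L) (AdeleRing (𝓞 (Fp L)) (Fp L)) y) ∈ ratH L e dV hdV dW hdW) ∧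
      Continuous n₀₁ ∧ (∀ x x', n₀₁ (x + x') = n₀₁ x * n₀₁ x') ∧ (∀ x, n₀₁ x ∈ unipDelta L e dV hdV dW hdW) ∧
      (∀ x, (blk L e dV hdV dW hdW (n₀₁ x)).toBlocks₁₂ = !![0, x; κ x, 0]) ∧
      (∀ x : L, n₀₁ (algebraMap L (AdeleRing (𝓞 L) L) x) ∈ ratH L e dV hdV dW hdW) ∧
      (∀ y x, n₀₀ y * n₀₁ x = n₀₁ x * n₀₀ y) ∧
      (∀ y (h : n₀₀ y ∈ unipDelta L e dV hdV dW hdW), (⟨n₀₀ y, h⟩ : unipDelta L e dV hdV dW hdW) ∈ Z) ∧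
      (∀ x (h : n₀₁ x ∈ unipDelta L e dV hdV dW hdW), (⟨n₀₁ x, h⟩ : unipDelta L e dV hdV dW hdW) ∈ Z) ∧
      c ≠ 0 ∧ c ≠ ∞ ∧
      (∀ Φ : HA L e dV hdV dW hdW → ℝ≥0∞, Measurable (fun z : Z => Φ ((z : unipDelta L e dV hdV dW hdW) : HA L e dV hdV dW hdW)) →
        ∫⁻ z, Φ ((z : unipDelta L e dV hdV dW hdW) : HA L e dV hdV dW hdW) ∂μZ = c * ∫⁻ y, ∫⁻ x, Φ (n₀₀ y * n₀₁ x) ∂μL ∂μ) ∧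
      ∀ {E : Type*} [NormedAddCommGroup E] [NormedSpace ℝ E] [CompleteSpace E] (φ : HA L e dV hdV dW hdW → E),
        Integrable (fun z : Z => φ ((z : unipDelta L e dV hdV dW hdW) : HA L e dV hdV dW hdW)) μZ →
        Integrable (fun y => ∫ x, φ (n₀₀ y * n₀₁ x) ∂μL) μ ∧
        ∫ z, φ ((z : unipDelta L e dV hdV dW hdW) : HA L e dV hdV dW hdW) ∂μZ = c.toReal • ∫ y, ∫ x, φ (n₀₀ y * n₀₁ x) ∂μL ∂μ := by
  classical
  haveI : T2Space (InfiniteAdeleRing L) := inferInstanceAs (T2Space ((v : InfinitePlace L) → v.Completion))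
  haveI : T2Space (FiniteAdeleRing (𝓞 L) L) :=
    inferInstanceAs (T2Space (RestrictedProduct (fun v : HeightOneSpectrum (𝓞 L) => v.adicCompletion L)
      (fun v => (v.adicCompletionIntegers L : Set (v.adicCompletion L))) Filter.cofinite))
  haveI : T2Space (AdeleRing (𝓞 L) L) := inferInstanceAs (T2Space (InfiniteAdeleRing L × FiniteAdeleRing (𝓞 L) L))
  haveI : T1Space (Multiplicative (AdeleRing (𝓞 L) L)) := inferInstanceAs (T1Space (AdeleRing (𝓞 L) L))
  haveI : LocallyCompactSpace (unipDelta L e dV hdV dW hdW) := locallyCompactSpace_unipDelta L e dV hdV dW hdW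
  haveI : SecondCountableTopology (unipDelta L e dV hdV dW hdW) := secondCountableTopology_unipDelta L e dV hdV dW hdW
  have hcommB : ∀ u v : unipDelta L e dV hdV dW hdW, u * v = v * u := fun u v => Subtype.ext (mul_comm_of_mem_unipDelta L e dV hdV dW hdW u.2 v.2)
  -- the membership law of `Z` in frame coordinates: `(X_u)₁₁ = 0`
  have hZ11 : ∀ u : unipDelta L e dV hdV dW hdW, u ∈ Z ↔ (blk L e dV hdV dW hdW (u : HA L e dV hdV dW hdW)).toBlocks₁₂ 1 1 = 0 := fun u => by
    rw [hZ u, ← stabilizer_reflStd_iff hg₀ Λ hΛ u.2]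
  -- `Z` is closed; instances on the carrier `↥Z`
  have hX11c : Continuous fun u : unipDelta L e dV hdV dW hdW => (blk L e dV hdV dW hdW (u : HA L e dV hdV dW hdW)).toBlocks₁₂ 1 1 :=
    ((continuous_toBlocks₁₂_blk L e dV hdV dW hdW).comp continuous_subtype_val).matrix_elem 1 1
  have hZc : IsClosed (Z : Set (unipDelta L e dV hdV dW hdW)) := by
    rw [show (Z : Set (unipDelta L e dV hdV dW hdW)) =
        {u : unipDelta L e dV hdV dW hdW | (blk L e dV hdV dW hdW (u : HA L e dV hdV dW hdW)).toBlocks₁₂ 1 1 = 0} from Set.ext fun u => hZ11 u]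
    exact isClosed_eq hX11c continuous_const
  haveI : LocallyCompactSpace Z := hZc.locallyCompactSpace
  haveI : SecondCountableTopology Z := TopologicalSpace.Subtype.secondCountableTopology (Z : Set (unipDelta L e dV hdV dW hdW))
  have hcommZ : ∀ u v : Z, u * v = v * u := fun u v => Subtype.ext (hcommB _ _)
  -- the plane coordinates (★ p861975)
  obtain ⟨n₀₀, n₀₁, κ, hc₀₀, hadd₀₀, h0₀₀, hmem₀₀, hX₀₀, hrat₀₀, hc₀₁, hadd₀₁, h0₀₁, hmem₀₁, hX₀₁, hrat₀₁, hcomm, hfac, hfac₁, hfac₀⟩ :=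
    exists_planeCoordinates L e dV hdV dW hdW hdV0 hdW0
  have hZmem₀₀ : ∀ y (h : n₀₀ y ∈ unipDelta L e dV hdV dW hdW), (⟨n₀₀ y, h⟩ : unipDelta L e dV hdV dW hdW) ∈ Z := fun y h => by
    rw [hZ11]
    show (blk L e dV hdV dW hdW (n₀₀ y)).toBlocks₁₂ 1 1 = 0
    rw [hX₀₀]
    simp
  have hZmem₀₁ : ∀ x (h : n₀₁ x ∈ unipDelta L e dV hdV dW hdW), (⟨n₀₁ x, h⟩ : unipDelta L e dV hdV dW hdW) ∈ Z := fun x h => by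
    rw [hZ11]
    show (blk L e dV hdV dW hdW (n₀₁ x)).toBlocks₁₂ 1 1 = 0
    rw [hX₀₁]
    simp
  -- the two families as maps into `↥Z`
  let aZ : AdeleRing (𝓞 (Fp L)) (Fp L) → Z := fun y => ⟨⟨n₀₀ y, hmem₀₀ y⟩, hZmem₀₀ y (hmem₀₀ y)⟩
  let bZ : AdeleRing (𝓞 L) L → Z := fun x => ⟨⟨n₀₁ x, hmem₀₁ x⟩, hZmem₀₁ x (hmem₀₁ x)⟩
  have haZcoe : ∀ y, (((aZ y : Z) : unipDelta L e dV hdV dW hdW) : HA L e dV hdV dW hdW) = n₀₀ y := fun _ => rfl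
  have hbZcoe : ∀ x, (((bZ x : Z) : unipDelta L e dV hdV dW hdW) : HA L e dV hdV dW hdW) = n₀₁ x := fun _ => rfl
  have haZc : Continuous aZ := (hc₀₀.subtype_mk _).subtype_mk _
  have hbZc : Continuous bZ := (hc₀₁.subtype_mk _).subtype_mk _
  have haZadd : ∀ s t, aZ (s + t) = aZ s * aZ t := fun s t => Subtype.ext (Subtype.ext (hadd₀₀ s t))
  have hbZadd : ∀ x x', bZ (x + x') = bZ x * bZ x' := fun x x' => Subtype.ext (Subtype.ext (hadd₀₁ x x'))
  have haZ0 : aZ 0 = 1 := Subtype.ext (Subtype.ext h0₀₀)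
  have hbZ0 : bZ 0 = 1 := Subtype.ext (Subtype.ext h0₀₁)
  -- frame coordinates along `Z`
  let XZ : Z → Matrix (Fin 2) (Fin 2) (AdeleRing (𝓞 L) L) := fun z => (blk L e dV hdV dW hdW ((z : unipDelta L e dV hdV dW hdW) : HA L e dV hdV dW hdW)).toBlocks₁₂
  have hXZc : Continuous XZ := ((continuous_toBlocks₁₂_blk L e dV hdV dW hdW).comp continuous_subtype_val).comp continuous_subtype_val
  have hXZmul : ∀ z z' : Z, XZ (z * z') = XZ z + XZ z' := fun z z' =>
    toBlocks₁₂_blk_mul L e dV hdV dW hdW (z : unipDelta L e dV hdV dW hdW).2 (z' : unipDelta L e dV hdV dW hdW).2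
  have hXZinv : ∀ z : Z, XZ z⁻¹ = -XZ z := fun z => toBlocks₁₂_blk_inv L e dV hdV dW hdW (z : unipDelta L e dV hdV dW hdW).2
  have hXZ11 : ∀ z : Z, XZ z 1 1 = 0 := fun z => (hZ11 _).1 z.2
  have hXZa : ∀ y, XZ (aZ y) = Matrix.single (0 : Fin 2) (0 : Fin 2) (AdeleRing.baseChange (Fp L) L y * algebraMap L (AdeleRing (𝓞 L) L) (imagUnit L)) :=
    fun y => hX₀₀ y
  have hXZb : ∀ x, XZ (bZ x) = !![0, x; κ x, 0] := fun x => hX₀₁ x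
  -- the `(0,0)` coordinate `im (X_z)₀₀` and the retraction onto the `n₀₀`-line
  let im : AdeleRing (𝓞 L) L → AdeleRing (𝓞 (Fp L)) (Fp L) := fun x =>
    ((quadraticAdeleEquiv (Fp L) L (IsCMField.complexConj L) (complexConj_imagUnit L) (imagUnit_ne_zero L)).symm x).2
  have himc : Continuous im := continuous_im L
  have him_a : ∀ y, im (XZ (aZ y) 0 0) = y := fun y => by
    rw [hXZa, Matrix.single_apply_same]
    exact im_baseChange_mul_delta L y
  let ρ₀ : Z → Z := fun z => aZ (im (XZ z 0 0))
  have hρ₀c : Continuous ρ₀ := haZc.comp (himc.comp (hXZc.matrix_elem 0 0))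
  have hρ₀a : ∀ y, ρ₀ (aZ y) = aZ y := fun y => by
    show aZ (im (XZ (aZ y) 0 0)) = aZ y
    rw [him_a]
  have hX00ρ₀ : ∀ z : Z, XZ (ρ₀ z) 0 0 = XZ z 0 0 := fun z => by
    show XZ (aZ (im _)) 0 0 = _
    rw [hXZa, Matrix.single_apply_same]
    exact baseChange_im_mul_delta L (conjAdele_toBlocks₁₂_diag_eq_neg L e dV hdV dW hdW hdV0 hdW0 (z : unipDelta L e dV hdV dW hdW).2 0)
  -- the subgroups `A = aZ(𝔸_{L⁺})` and `Z₁ = {z : (X_z)₀₀ = 0}` of `Z`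
  let aH : Multiplicative (AdeleRing (𝓞 (Fp L)) (Fp L)) →* Z :=
    { toFun := fun t => aZ (Multiplicative.toAdd t)
      map_one' := haZ0
      map_mul' := fun s t => haZadd _ _ }
  set A : Subgroup Z := aH.range with hAdef
  have hmemA : ∀ u, u ∈ A ↔ ∃ t, aZ t = u := fun u =>
    ⟨fun ⟨t, ht⟩ => ⟨Multiplicative.toAdd t, ht⟩, fun ⟨t, ht⟩ => ⟨Multiplicative.ofAdd t, ht⟩⟩
  have hAfix : ∀ u, u ∈ A ↔ ρ₀ u = u := fun u => by
    rw [hmemA]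
    constructor
    · rintro ⟨t, rfl⟩
      exact hρ₀a t
    · intro h
      exact ⟨_, h⟩
  have hAc : IsClosed (A : Set Z) := by
    rw [show (A : Set Z) = {u | ρ₀ u = u} from Set.ext hAfix]
    exact isClosed_eq hρ₀c continuous_id
  let κH : Z →* Multiplicative (AdeleRing (𝓞 L) L) :=
    { toFun := fun z => Multiplicative.ofAdd (XZ z 0 0)
      map_one' := by
        show Multiplicative.ofAdd (XZ 1 0 0) = 1
        have h1 : XZ 1 = 0 := toBlocks₁₂_blk_one L e dV hdV dW hdW
        rw [h1, Matrix.zero_apply, ofAdd_zero]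
      map_mul' := fun z z' => by
        show Multiplicative.ofAdd (XZ (z * z') 0 0) = Multiplicative.ofAdd (XZ z 0 0) * Multiplicative.ofAdd (XZ z' 0 0)
        rw [hXZmul, Matrix.add_apply, ofAdd_add] }
  have hκHc : Continuous κH := continuous_ofAdd.comp (hXZc.matrix_elem 0 0)
  set Z₁ : Subgroup Z := κH.ker with hZ₁def
  have hker : ∀ z : Z, z ∈ Z₁ ↔ XZ z 0 0 = 0 := fun z => by
    rw [hZ₁def, MonoidHom.mem_ker]
    exact ofAdd_eq_one
  have hZ₁c : IsClosed (Z₁ : Set Z) := by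
    rw [hZ₁def, MonoidHom.coe_ker]
    exact isClosed_singleton.preimage hκHc
  -- the retraction
  let ρ : Z → A := fun u => ⟨ρ₀ u, (hmemA _).2 ⟨_, rfl⟩⟩
  have hρc : Continuous ρ := hρ₀c.subtype_mk _
  have hρ : ∀ (a : A) (z : Z₁), ρ ((a : Z) * z) = a := fun a z => by
    obtain ⟨t, ht⟩ := (hmemA a).1 a.2
    apply Subtype.ext
    show aZ (im (XZ ((a : Z) * (z : Z)) 0 0)) = a
    rw [hXZmul, Matrix.add_apply, (hker _).1 z.2, add_zero, ← ht, him_a]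
  have hρZ : ∀ b : Z, ((ρ b : Z))⁻¹ * b ∈ Z₁ := fun b => by
    refine (hker _).2 ?_
    rw [hXZmul, hXZinv, Matrix.add_apply, Matrix.neg_apply]
    show -(XZ (ρ₀ b) 0 0) + XZ b 0 0 = 0
    rw [hX00ρ₀, neg_add_cancel]
  have hnorm : ∀ (a : A) (z : Z₁), (a : Z)⁻¹ * (z : Z) * a ∈ Z₁ := fun a z => by
    rw [hcommZ _ (a : Z), ← mul_assoc, mul_inv_cancel, one_mul]
    exact z.2
  obtain ⟨eAZ, hsd⟩ := exists_homeomorph_isTopSemidirect_of_retraction A Z₁ ρ hρc hρ hρZ hAc hZ₁c hnorm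
  haveI : LocallyCompactSpace Z₁ := hZ₁c.locallyCompactSpace
  -- the coordinate homeomorphisms `𝔸_{L⁺} ≃ₜ A`, `𝔸_L ≃ₜ Z₁`
  let eA : AdeleRing (𝓞 (Fp L)) (Fp L) ≃ₜ A :=
    { toFun := fun t => ⟨aZ t, (hmemA _).2 ⟨t, rfl⟩⟩
      invFun := fun a => im (XZ (a : Z) 0 0)
      left_inv := fun t => him_a t
      right_inv := fun a => Subtype.ext ((hAfix a).1 a.2)
      continuous_toFun := haZc.subtype_mk _
      continuous_invFun := himc.comp ((hXZc.matrix_elem 0 0).comp continuous_subtype_val) }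
  have hbZker : ∀ x, bZ x ∈ Z₁ := fun x => by
    rw [hker, hXZb]
    simp
  let eZ₁ : AdeleRing (𝓞 L) L ≃ₜ Z₁ :=
    { toFun := fun x => ⟨bZ x, hbZker x⟩
      invFun := fun z => XZ (z : Z) 0 1
      left_inv := fun x => by
        show XZ (bZ x) 0 1 = x
        rw [hXZb]
        simp
      right_inv := fun z => by
        apply Subtype.ext
        apply Subtype.ext
        apply Subtype.ext
        show n₀₁ (XZ (z : Z) 0 1) = (((z : Z) : unipDelta L e dV hdV dW hdW) : HA L e dV hdV dW hdW)
        exact hfac₁ _ ((z : Z) : unipDelta L e dV hdV dW hdW).2 (hXZ11 _) ((hker _).1 z.2)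
      continuous_toFun := hbZc.subtype_mk _
      continuous_invFun := (hXZc.matrix_elem 0 1).comp continuous_subtype_val }
  haveI : IsHaarMeasure (μ.map eA) := isHaarMeasure_map_of_homeomorph_add μ eA fun s t => Subtype.ext (haZadd s t)
  haveI : IsHaarMeasure (μL.map eZ₁) := isHaarMeasure_map_of_homeomorph_add μL eZ₁ fun x x' => Subtype.ext (hbZadd x x')
  obtain ⟨c, hc0, hctop, hlin, hboch⟩ := exists_semidirect_integral (μ.map eA) (μL.map eZ₁) μZ hsd
  have heA : ∀ t, ((((eA t : A) : Z) : unipDelta L e dV hdV dW hdW) : HA L e dV hdV dW hdW) = n₀₀ t := fun t => rfl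
  have heZ₁ : ∀ x, ((((eZ₁ x : Z₁) : Z) : unipDelta L e dV hdV dW hdW) : HA L e dV hdV dW hdW) = n₀₁ x := fun x => rfl
  have hprodcoe : ∀ (a : A) (z : Z₁), ((((a : Z) * (z : Z) : Z) : unipDelta L e dV hdV dW hdW) : HA L e dV hdV dW hdW) =
      (((a : Z) : unipDelta L e dV hdV dW hdW) : HA L e dV hdV dW hdW) * (((z : Z) : unipDelta L e dV hdV dW hdW) : HA L e dV hdV dW hdW) := fun a z => rfl
  refine ⟨n₀₀, n₀₁, κ, c, hc₀₀, hadd₀₀, hmem₀₀, hX₀₀, hrat₀₀, hc₀₁, hadd₀₁, hmem₀₁, hX₀₁, hrat₀₁, hcomm, hZmem₀₀, hZmem₀₁, hc0, hctop,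
    fun Φ hΦm => ?_, fun φ hφ => ?_⟩
  · -- (LIN)
    have hinner : ∀ a : A, ∫⁻ z, Φ ((((a : Z) * (z : Z) : Z) : unipDelta L e dV hdV dW hdW) : HA L e dV hdV dW hdW) ∂(μL.map eZ₁) =
        ∫⁻ x, Φ ((((a : Z) : unipDelta L e dV hdV dW hdW) : HA L e dV hdV dW hdW) * n₀₁ x) ∂μL := fun a => by
      have h := lintegral_map_equiv (μ := μL) (fun z : Z₁ => Φ ((((a : Z) * (z : Z) : Z) : unipDelta L e dV hdV dW hdW) : HA L e dV hdV dW hdW)) eZ₁.toMeasurableEquiv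
      rw [Homeomorph.toMeasurableEquiv_coe] at h
      rw [h]
      rfl
    have houter := lintegral_map_equiv (μ := μ) (fun a : A => ∫⁻ x, Φ ((((a : Z) : unipDelta L e dV hdV dW hdW) : HA L e dV hdV dW hdW) * n₀₁ x) ∂μL) eA.toMeasurableEquiv
    rw [Homeomorph.toMeasurableEquiv_coe] at houter
    rw [hlin (fun b : Z => Φ ((b : unipDelta L e dV hdV dW hdW) : HA L e dV hdV dW hdW)) hΦm]
    simp_rw [hinner]
    rw [houter]
    rfl
  · -- (BOCH)
    obtain ⟨-, hint, heq⟩ := hboch (fun b : Z => φ ((b : unipDelta L e dV hdV dW hdW) : HA L e dV hdV dW hdW)) hφ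
    have hinner : ∀ a : A, ∫ z, φ ((((a : Z) * (z : Z) : Z) : unipDelta L e dV hdV dW hdW) : HA L e dV hdV dW hdW) ∂(μL.map eZ₁) =
        ∫ x, φ ((((a : Z) : unipDelta L e dV hdV dW hdW) : HA L e dV hdV dW hdW) * n₀₁ x) ∂μL := fun a => by
      have h := integral_map_equiv (μ := μL) eZ₁.toMeasurableEquiv (fun z : Z₁ => φ ((((a : Z) * (z : Z) : Z) : unipDelta L e dV hdV dW hdW) : HA L e dV hdV dW hdW))
      rw [Homeomorph.toMeasurableEquiv_coe] at h
      rw [h]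
      rfl
    simp_rw [hinner] at hint heq
    have htrI := integrable_map_equiv (μ := μ) eA.toMeasurableEquiv
      (fun a : A => ∫ x, φ ((((a : Z) : unipDelta L e dV hdV dW hdW) : HA L e dV hdV dW hdW) * n₀₁ x) ∂μL)
    have htr := integral_map_equiv (μ := μ) eA.toMeasurableEquiv
      (fun a : A => ∫ x, φ ((((a : Z) : unipDelta L e dV hdV dW hdW) : HA L e dV hdV dW hdW) * n₀₁ x) ∂μL)
    rw [Homeomorph.toMeasurableEquiv_coe] at htrI htr
    exact ⟨htrI.1 hint, heq.trans (by rw [htr]; rfl)⟩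

end Summit.HodgeConjecture.HodgeConjecture.Cruxes.HLiu418.K2LiuRankOneCornerComplementFubini

end
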